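import Mathlib
import HarnessLib
import Summits.Ventures.LatticeQCDFlow.Scaling.AcceptanceVolumeFloorRigidityIntegral

/-!
# LatticeQCDFlow / Scaling — rigidity of the acceptance volume floor on a GENERAL space, II:
# `acc(p,q)·acc(p′,q′) = acc(p⊗p′, q⊗q′)` iff one of the two blocks is hit-or-miss almost everywhere

HONEST FRAMING: exact (Metropolis-corrected) sampling algorithms for lattice gauge theory;
figures of merit are autocorrelation/cost numbers at stated couplings and volumes; no
continuum-physics claim.

Venture `LatticeQCDFlow` (cell pub-lqcd), topic `Scaling`; FANOUT row 3 (`s0-u1-a`, S0-B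
implementation A, GEN-13).  NEW WORK of the cell (elementary measure theory); NO definition is
introduced.  Part I (`Scaling/AcceptanceVolumeFloorRigidityIntegral`, imported) set up, for s-finite
reference measures `μ` on `X`, `μ′` on `Y`, normalised targets `p, p′ ≥ 0` and models `q, q′ > 0`, the
product-pair acceptance kernel `K` and the product `L ≤ K` of the block kernels on
`M = (μ⊗μ′)⊗(μ⊗μ′)`, with `acc(p⊗p′, q⊗q′) − acc(p,q)·acc(p′,q′) = ∫ (K − L) dM`, and showed that a
block which is not hit-or-miss a.e. (`¬ ∃ c, ∀ᵐ x ∂μ, 0 < p x → p x / q x = c`) charges both ORIENTED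
pair sets `{0 < p(a)q(b) < p(b)q(a)}`.  Here:

* §1 `min_mul_min_eq_of_cases_left/right` — the pointwise equality cases `L = K` (a zero or two equal
  cross products in one block), from row 3's finite `Scaling/AcceptanceVolumeFloorRigidity`;
* §2 **`mul_meanAccept_eq_meanAccept_prod_of_hitOrMiss_ae_left`** / **`…_right`** — a block that is
  hit-or-miss a.e. gives `K = L` `M`-a.e. (transport along the quasi-measure-preserving coordinate
  maps), hence `acc·acc′ = acc(⊗)`;
* §3 **`mul_meanAccept_lt_meanAccept_prod`** — if NEITHER block is hit-or-miss a.e. then `K > L` on the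
  re-paired rectangle (oriented pairs of block 1) × (reversed oriented pairs of block 2), which has
  positive `M`-measure (`measurePreserving_rePair`, `Measure.prod_prod`), so `∫ (K − L) dM > 0`:
  STRICT super-multiplicativity `acc(p,q)·acc(p′,q′) < acc(p⊗p′, q⊗q′)`;
* **`mul_meanAccept_eq_meanAccept_prod_iff`** — `acc(p,q)·acc(p′,q′) = acc(p⊗p′, q⊗q′) ↔` block 1 is
  hit-or-miss a.e. `∨` block 2 is hit-or-miss a.e. — the general-space form of row 3's finite
  `accRate_prodLaw_eq_mul_iff`.

Reading (value-free): on arbitrary configuration spaces — the setting of the cell's continuous-field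
flows — the product of two block acceptances is the exact acceptance of the glued sampler only in the
degenerate all-or-nothing case; graded blocks always gain strictly from gluing.
NOT CLAIMED: the `m`-block general-space form; a quantitative excess; coupled flows; any number of ours.
-/

namespace Summit.Ventures.LatticeQCDFlow.Theory2

open MeasureTheory Set

/-! ## §1 Pointwise equality cases -/

section Pointwise

/-- `min(A,A′)·min(B,B′) = min(AB, A′B′)` when block 1 shows a zero or two equal cross products.
[ours] -/
theorem min_mul_min_eq_of_cases_left {A A' B B' : ℝ} (hA : 0 ≤ A) (hA' : 0 ≤ A') (hB : 0 ≤ B)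
    (hB' : 0 ≤ B') (h : A = 0 ∨ A' = 0 ∨ A = A') :
    min A A' * min B B' = min (A * B) (A' * B') := by
  rcases h with h | h | h
  · rw [h]
    exact min_mul_min_eq_of_zero_left hA' hB'
  · rw [h]
    exact min_mul_min_eq_of_zero_right hA hB
  · rw [← h]
    exact min_mul_min_eq_of_eq hA

/-- `min(A,A′)·min(B,B′) = min(AB, A′B′)` when block 2 shows a zero or two equal cross products.
[ours] -/
theorem min_mul_min_eq_of_cases_right {A A' B B' : ℝ} (hA : 0 ≤ A) (hA' : 0 ≤ A') (hB : 0 ≤ B)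
    (hB' : 0 ≤ B') (h : B = 0 ∨ B' = 0 ∨ B = B') :
    min A A' * min B B' = min (A * B) (A' * B') := by
  rw [mul_comm, min_mul_min_eq_of_cases_left hB hB' hA hA' h, mul_comm B A, mul_comm B' A']

end Pointwise

/-! ## §2 A hit-or-miss block gives `K = L` almost everywhere -/

section TwoBlocks

variable {X Y : Type*} [MeasurableSpace X] [MeasurableSpace Y] {μ : Measure X} {μ' : Measure Y}
  [SFinite μ] [SFinite μ'] {p q : X → ℝ} {p' q' : Y → ℝ}

omit [MeasurableSpace X] [MeasurableSpace Y] [SFinite μ] [SFinite μ'] in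
/-- The kernel `K` in the arrangement `min(A·B, A′·B′)` of the block cross products. [folklore] -/
theorem prodKernel_eq_arranged (e : (X × Y) × (X × Y)) :
    min (p e.1.1 * p' e.1.2 * (q e.2.1 * q' e.2.2)) (p e.2.1 * p' e.2.2 * (q e.1.1 * q' e.1.2))
      = min (p e.1.1 * q e.2.1 * (p' e.1.2 * q' e.2.2)) (p e.2.1 * q e.1.1 * (p' e.2.2 * q' e.1.2)) := by
  congr 1 <;> ring

omit [MeasurableSpace X] [MeasurableSpace Y] [SFinite μ] [SFinite μ'] in
/-- Weight conditions of block 1 at the two charged states give the equality cases. [ours] -/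
theorem cases_left_of_weights (hp0 : ∀ x, 0 ≤ p x) (hq0 : ∀ x, 0 < q x) {c : ℝ} {a b : X}
    (ha : 0 < p a → p a / q a = c) (hb : 0 < p b → p b / q b = c) :
    p a * q b = 0 ∨ p b * q a = 0 ∨ p a * q b = p b * q a := by
  by_cases hpa : p a = 0
  · exact Or.inl (by rw [hpa, zero_mul])
  by_cases hpb : p b = 0
  · exact Or.inr (Or.inl (by rw [hpb, zero_mul]))
  have h := (ha ((hp0 a).lt_of_ne' hpa)).trans (hb ((hp0 b).lt_of_ne' hpb)).symm
  rw [div_eq_div_iff (hq0 a).ne' (hq0 b).ne'] at h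
  exact Or.inr (Or.inr h)

omit [SFinite μ] [SFinite μ'] in
/-- **Block 1 hit-or-miss a.e. ⇒ `K = L` `M`-a.e.** [ours] -/
theorem blockKernelProd_ae_eq_prodKernel_of_left (hp0 : ∀ x, 0 ≤ p x) (hq0 : ∀ x, 0 < q x)
    (hp0' : ∀ y, 0 ≤ p' y) (hq0' : ∀ y, 0 < q' y) (h : ∃ c : ℝ, ∀ᵐ x ∂μ, 0 < p x → p x / q x = c) :
    (fun e : (X × Y) × (X × Y) =>
        min (p e.1.1 * q e.2.1) (p e.2.1 * q e.1.1) * min (p' e.1.2 * q' e.2.2) (p' e.2.2 * q' e.1.2))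
      =ᵐ[(μ.prod μ').prod (μ.prod μ')] fun e =>
        min (p e.1.1 * p' e.1.2 * (q e.2.1 * q' e.2.2)) (p e.2.1 * p' e.2.2 * (q e.1.1 * q' e.1.2)) := by
  obtain ⟨c, hc⟩ := h
  have h11 : Measure.QuasiMeasurePreserving (fun e : (X × Y) × (X × Y) => e.1.1)
      ((μ.prod μ').prod (μ.prod μ')) μ :=
    (Measure.quasiMeasurePreserving_fst (μ := μ) (ν := μ')).comp
      (Measure.quasiMeasurePreserving_fst (μ := μ.prod μ') (ν := μ.prod μ'))
  have h21 : Measure.QuasiMeasurePreserving (fun e : (X × Y) × (X × Y) => e.2.1)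
      ((μ.prod μ').prod (μ.prod μ')) μ :=
    (Measure.quasiMeasurePreserving_fst (μ := μ) (ν := μ')).comp
      (Measure.quasiMeasurePreserving_snd (μ := μ.prod μ') (ν := μ.prod μ'))
  filter_upwards [h11.ae hc, h21.ae hc] with e ha hb
  rw [prodKernel_eq_arranged]
  exact min_mul_min_eq_of_cases_left (mul_nonneg (hp0 _) (hq0 _).le) (mul_nonneg (hp0 _) (hq0 _).le)
    (mul_nonneg (hp0' _) (hq0' _).le) (mul_nonneg (hp0' _) (hq0' _).le)
    (cases_left_of_weights hp0 hq0 ha hb)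

omit [SFinite μ] [SFinite μ'] in
/-- **Block 2 hit-or-miss a.e. ⇒ `K = L` `M`-a.e.** [ours] -/
theorem blockKernelProd_ae_eq_prodKernel_of_right (hp0 : ∀ x, 0 ≤ p x) (hq0 : ∀ x, 0 < q x)
    (hp0' : ∀ y, 0 ≤ p' y) (hq0' : ∀ y, 0 < q' y)
    (h : ∃ c : ℝ, ∀ᵐ y ∂μ', 0 < p' y → p' y / q' y = c) :
    (fun e : (X × Y) × (X × Y) =>
        min (p e.1.1 * q e.2.1) (p e.2.1 * q e.1.1) * min (p' e.1.2 * q' e.2.2) (p' e.2.2 * q' e.1.2))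
      =ᵐ[(μ.prod μ').prod (μ.prod μ')] fun e =>
        min (p e.1.1 * p' e.1.2 * (q e.2.1 * q' e.2.2)) (p e.2.1 * p' e.2.2 * (q e.1.1 * q' e.1.2)) := by
  obtain ⟨c, hc⟩ := h
  have h12 : Measure.QuasiMeasurePreserving (fun e : (X × Y) × (X × Y) => e.1.2)
      ((μ.prod μ').prod (μ.prod μ')) μ' :=
    (Measure.quasiMeasurePreserving_snd (μ := μ) (ν := μ')).comp
      (Measure.quasiMeasurePreserving_fst (μ := μ.prod μ') (ν := μ.prod μ'))
  have h22 : Measure.QuasiMeasurePreserving (fun e : (X × Y) × (X × Y) => e.2.2)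
      ((μ.prod μ').prod (μ.prod μ')) μ' :=
    (Measure.quasiMeasurePreserving_snd (μ := μ) (ν := μ')).comp
      (Measure.quasiMeasurePreserving_snd (μ := μ.prod μ') (ν := μ.prod μ'))
  filter_upwards [h12.ae hc, h22.ae hc] with e ha hb
  rw [prodKernel_eq_arranged]
  exact min_mul_min_eq_of_cases_right (mul_nonneg (hp0 _) (hq0 _).le) (mul_nonneg (hp0 _) (hq0 _).le)
    (mul_nonneg (hp0' _) (hq0' _).le) (mul_nonneg (hp0' _) (hq0' _).le)
    (cases_left_of_weights hp0' hq0' ha hb)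

/-- From `K = L` a.e. to the equality of the acceptances. [ours] -/
theorem mul_meanAccept_eq_meanAccept_prod_of_ae_eq (hp0 : ∀ x, 0 ≤ p x) (hpm : Measurable p)
    (hpi : Integrable p μ) (hq0 : ∀ x, 0 < q x) (hqm : Measurable q) (hqi : Integrable q μ)
    (hp0' : ∀ y, 0 ≤ p' y) (hpm' : Measurable p') (hpi' : Integrable p' μ') (hq0' : ∀ y, 0 < q' y)
    (hqm' : Measurable q') (hqi' : Integrable q' μ')
    (hKL : (fun e : (X × Y) × (X × Y) =>
        min (p e.1.1 * q e.2.1) (p e.2.1 * q e.1.1) * min (p' e.1.2 * q' e.2.2) (p' e.2.2 * q' e.1.2))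
      =ᵐ[(μ.prod μ').prod (μ.prod μ')] fun e =>
        min (p e.1.1 * p' e.1.2 * (q e.2.1 * q' e.2.2)) (p e.2.1 * p' e.2.2 * (q e.1.1 * q' e.1.2))) :
    (∫ a, ∫ b, min (p a * q b) (p b * q a) ∂μ ∂μ) * (∫ c, ∫ d, min (p' c * q' d) (p' d * q' c) ∂μ' ∂μ')
      = ∫ z, ∫ z', min (p z.1 * p' z.2 * (q z'.1 * q' z'.2)) (p z'.1 * p' z'.2 * (q z.1 * q' z.2))
          ∂(μ.prod μ') ∂(μ.prod μ') := by
  refine (sub_eq_zero.1 ?_).symm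
  rw [meanAccept_prod_sub_mul_eq_integral hp0 hpm hpi hq0 hqm hqi hp0' hpm' hpi' hq0' hqm' hqi']
  have h0 : (fun e : (X × Y) × (X × Y) =>
      min (p e.1.1 * p' e.1.2 * (q e.2.1 * q' e.2.2)) (p e.2.1 * p' e.2.2 * (q e.1.1 * q' e.1.2))
        - min (p e.1.1 * q e.2.1) (p e.2.1 * q e.1.1) * min (p' e.1.2 * q' e.2.2) (p' e.2.2 * q' e.1.2))
      =ᵐ[(μ.prod μ').prod (μ.prod μ')] fun _ => (0 : ℝ) := by
    filter_upwards [hKL] with e he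
    rw [he, sub_self]
  rw [integral_congr_ae h0, integral_zero]

/-- **BLOCK 1 HIT-OR-MISS a.e. ⇒ THE FLOOR IS ATTAINED**: `acc(p,q)·acc(p′,q′) = acc(p⊗p′, q⊗q′)`.
[ours] -/
theorem mul_meanAccept_eq_meanAccept_prod_of_hitOrMiss_ae_left (hp0 : ∀ x, 0 ≤ p x)
    (hpm : Measurable p) (hpi : Integrable p μ) (hq0 : ∀ x, 0 < q x) (hqm : Measurable q)
    (hqi : Integrable q μ) (hp0' : ∀ y, 0 ≤ p' y) (hpm' : Measurable p') (hpi' : Integrable p' μ')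
    (hq0' : ∀ y, 0 < q' y) (hqm' : Measurable q') (hqi' : Integrable q' μ')
    (h : ∃ c : ℝ, ∀ᵐ x ∂μ, 0 < p x → p x / q x = c) :
    (∫ a, ∫ b, min (p a * q b) (p b * q a) ∂μ ∂μ) * (∫ c, ∫ d, min (p' c * q' d) (p' d * q' c) ∂μ' ∂μ')
      = ∫ z, ∫ z', min (p z.1 * p' z.2 * (q z'.1 * q' z'.2)) (p z'.1 * p' z'.2 * (q z.1 * q' z.2))
          ∂(μ.prod μ') ∂(μ.prod μ') :=
  mul_meanAccept_eq_meanAccept_prod_of_ae_eq hp0 hpm hpi hq0 hqm hqi hp0' hpm' hpi' hq0' hqm' hqi'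
    (blockKernelProd_ae_eq_prodKernel_of_left hp0 hq0 hp0' hq0' h)

/-- **BLOCK 2 HIT-OR-MISS a.e. ⇒ THE FLOOR IS ATTAINED.** [ours] -/
theorem mul_meanAccept_eq_meanAccept_prod_of_hitOrMiss_ae_right (hp0 : ∀ x, 0 ≤ p x)
    (hpm : Measurable p) (hpi : Integrable p μ) (hq0 : ∀ x, 0 < q x) (hqm : Measurable q)
    (hqi : Integrable q μ) (hp0' : ∀ y, 0 ≤ p' y) (hpm' : Measurable p') (hpi' : Integrable p' μ')
    (hq0' : ∀ y, 0 < q' y) (hqm' : Measurable q') (hqi' : Integrable q' μ')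
    (h : ∃ c : ℝ, ∀ᵐ y ∂μ', 0 < p' y → p' y / q' y = c) :
    (∫ a, ∫ b, min (p a * q b) (p b * q a) ∂μ ∂μ) * (∫ c, ∫ d, min (p' c * q' d) (p' d * q' c) ∂μ' ∂μ')
      = ∫ z, ∫ z', min (p z.1 * p' z.2 * (q z'.1 * q' z'.2)) (p z'.1 * p' z'.2 * (q z.1 * q' z.2))
          ∂(μ.prod μ') ∂(μ.prod μ') :=
  mul_meanAccept_eq_meanAccept_prod_of_ae_eq hp0 hpm hpi hq0 hqm hqi hp0' hpm' hpi' hq0' hqm' hqi'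
    (blockKernelProd_ae_eq_prodKernel_of_right hp0 hq0 hp0' hq0' h)

/-! ## §3 Two graded blocks gain strictly; the equality case -/

/-- **STRICT SUPER-MULTIPLICATIVITY ON A GENERAL SPACE**: if neither block is hit-or-miss a.e. then
`acc(p,q)·acc(p′,q′) < acc(p⊗p′, q⊗q′)`. [ours] -/
theorem mul_meanAccept_lt_meanAccept_prod (hp0 : ∀ x, 0 ≤ p x) (hpm : Measurable p)
    (hpi : Integrable p μ) (hp1 : ∫ x, p x ∂μ = 1) (hq0 : ∀ x, 0 < q x) (hqm : Measurable q)
    (hqi : Integrable q μ) (hp0' : ∀ y, 0 ≤ p' y) (hpm' : Measurable p') (hpi' : Integrable p' μ')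
    (hp1' : ∫ y, p' y ∂μ' = 1) (hq0' : ∀ y, 0 < q' y) (hqm' : Measurable q') (hqi' : Integrable q' μ')
    (h : ¬ ∃ c : ℝ, ∀ᵐ x ∂μ, 0 < p x → p x / q x = c)
    (h' : ¬ ∃ c : ℝ, ∀ᵐ y ∂μ', 0 < p' y → p' y / q' y = c) :
    (∫ a, ∫ b, min (p a * q b) (p b * q a) ∂μ ∂μ) * (∫ c, ∫ d, min (p' c * q' d) (p' d * q' c) ∂μ' ∂μ')
      < ∫ z, ∫ z', min (p z.1 * p' z.2 * (q z'.1 * q' z'.2)) (p z'.1 * p' z'.2 * (q z.1 * q' z.2))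
          ∂(μ.prod μ') ∂(μ.prod μ') := by
  -- the two oriented pair sets and the re-paired rectangle
  set S₁ : Set (X × X) := {z | 0 < p z.1 * q z.2 ∧ p z.1 * q z.2 < p z.2 * q z.1} with hS₁
  set S₂ : Set (Y × Y) := {z | 0 < p' z.2 * q' z.1 ∧ p' z.2 * q' z.1 < p' z.1 * q' z.2} with hS₂
  have hS₁m : MeasurableSet S₁ := measurableSet_crossLt hpm hqm
  have hS₂m : MeasurableSet S₂ := by
    have hf : Measurable fun z : Y × Y => p' z.2 * q' z.1 :=
      (hpm'.comp measurable_snd).mul (hqm'.comp measurable_fst)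
    have hg : Measurable fun z : Y × Y => p' z.1 * q' z.2 :=
      (hpm'.comp measurable_fst).mul (hqm'.comp measurable_snd)
    exact (measurableSet_lt measurable_const hf).inter (measurableSet_lt hf hg)
  have hS₁pos : 0 < (μ.prod μ) S₁ := measure_crossLt_pos hp0 hpm hp1 hq0 hqm h
  have hS₂pos : 0 < (μ'.prod μ') S₂ := measure_crossGt_pos hp0' hpm' hp1' hq0' hqm' h'
  have hT := measurePreserving_rePair μ μ'
  set T : Set ((X × Y) × (X × Y)) :=
    (fun e : (X × Y) × (X × Y) => ((e.1.1, e.2.1), (e.1.2, e.2.2))) ⁻¹' (S₁ ×ˢ S₂) with hTdef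
  have hTpos : 0 < ((μ.prod μ').prod (μ.prod μ')) T := by
    rw [hTdef, hT.measure_preimage (hS₁m.prod hS₂m).nullMeasurableSet, Measure.prod_prod]
    exact ENNReal.mul_pos hS₁pos.ne' hS₂pos.ne'
  -- the defect integrand is nonnegative, integrable, and positive on `T`
  set f : (X × Y) × (X × Y) → ℝ := fun e =>
    min (p e.1.1 * p' e.1.2 * (q e.2.1 * q' e.2.2)) (p e.2.1 * p' e.2.2 * (q e.1.1 * q' e.1.2))
      - min (p e.1.1 * q e.2.1) (p e.2.1 * q e.1.1) * min (p' e.1.2 * q' e.2.2) (p' e.2.2 * q' e.1.2)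
    with hfdef
  have hf0 : ∀ e, 0 ≤ f e := fun e => sub_nonneg.2 (blockKernelProd_le_prodKernel hp0 hq0 hp0' hq0' e)
  have hfi : Integrable f ((μ.prod μ').prod (μ.prod μ')) :=
    (integrable_prodKernel hp0 hpm hpi hq0 hqm hqi hp0' hpm' hpi' hq0' hqm' hqi').sub
      (integrable_blockKernelProd hp0 hpm hpi hq0 hqm hqi hp0' hpm' hpi' hq0' hqm' hqi')
  have hfT : ∀ e ∈ T, 0 < f e := by
    intro e he
    obtain ⟨⟨ha, haa'⟩, ⟨hb', hb'b⟩⟩ := he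
    have hlt := min_mul_min_lt_min_mul ha haa' hb' hb'b
    rw [hfdef]
    simp only
    rw [prodKernel_eq_arranged]
    exact sub_pos.2 hlt
  -- hence its integral is positive
  have hne : ∫ e, f e ∂((μ.prod μ').prod (μ.prod μ')) ≠ 0 := by
    intro h0
    have hae : f =ᵐ[(μ.prod μ').prod (μ.prod μ')] 0 := (integral_eq_zero_iff_of_nonneg hf0 hfi).1 h0
    have hT0 : ((μ.prod μ').prod (μ.prod μ')) T = 0 := by
      refine measure_eq_zero_iff_ae_notMem.2 (hae.mono fun e he heT => ?_)
      exact (hfT e heT).ne' he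
    exact hTpos.ne' hT0
  have hpos : 0 < ∫ e, f e ∂((μ.prod μ').prod (μ.prod μ')) :=
    lt_of_le_of_ne (integral_nonneg hf0) (Ne.symm hne)
  rw [hfdef, ← meanAccept_prod_sub_mul_eq_integral hp0 hpm hpi hq0 hqm hqi hp0' hpm' hpi' hq0' hqm'
    hqi'] at hpos
  exact sub_pos.1 hpos

/-- **RIGIDITY OF THE ACCEPTANCE VOLUME FLOOR ON A GENERAL SPACE**: for normalised targets `p, p′ ≥ 0`
and positive models `q, q′` on arbitrary s-finite measure spaces,
`acc(p,q)·acc(p′,q′) = acc(p⊗p′, q⊗q′)` iff block 1 or block 2 is hit-or-miss almost everywhere.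
[ours] -/
theorem mul_meanAccept_eq_meanAccept_prod_iff (hp0 : ∀ x, 0 ≤ p x) (hpm : Measurable p)
    (hpi : Integrable p μ) (hp1 : ∫ x, p x ∂μ = 1) (hq0 : ∀ x, 0 < q x) (hqm : Measurable q)
    (hqi : Integrable q μ) (hp0' : ∀ y, 0 ≤ p' y) (hpm' : Measurable p') (hpi' : Integrable p' μ')
    (hp1' : ∫ y, p' y ∂μ' = 1) (hq0' : ∀ y, 0 < q' y) (hqm' : Measurable q') (hqi' : Integrable q' μ') :
    (∫ a, ∫ b, min (p a * q b) (p b * q a) ∂μ ∂μ) * (∫ c, ∫ d, min (p' c * q' d) (p' d * q' c) ∂μ' ∂μ')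
      = ∫ z, ∫ z', min (p z.1 * p' z.2 * (q z'.1 * q' z'.2)) (p z'.1 * p' z'.2 * (q z.1 * q' z.2))
          ∂(μ.prod μ') ∂(μ.prod μ') ↔
      (∃ c : ℝ, ∀ᵐ x ∂μ, 0 < p x → p x / q x = c) ∨
      (∃ c : ℝ, ∀ᵐ y ∂μ', 0 < p' y → p' y / q' y = c) := by
  constructor
  · intro heq
    by_contra hne
    obtain ⟨h, h'⟩ := not_or.1 hne
    exact (mul_meanAccept_lt_meanAccept_prod hp0 hpm hpi hp1 hq0 hqm hqi hp0' hpm' hpi' hp1' hq0' hqm'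
      hqi' h h').ne heq
  · rintro (h | h)
    · exact mul_meanAccept_eq_meanAccept_prod_of_hitOrMiss_ae_left hp0 hpm hpi hq0 hqm hqi hp0' hpm'
        hpi' hq0' hqm' hqi' h
    · exact mul_meanAccept_eq_meanAccept_prod_of_hitOrMiss_ae_right hp0 hpm hpi hq0 hqm hqi hp0' hpm'
        hpi' hq0' hqm' hqi' h

end TwoBlocks

end Summit.Ventures.LatticeQCDFlow.Theory2
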